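import Literature.Probability.RandomPlanarGeometry.SAWPulledBridgeFreeEnergyZdThirdOrderLower
import HarnessLib

/-!
# The pulled-bridge free energy on `ℤ^{d+1}` from below at FOURTH order:
# `e^{λ_B(y)} ≥ y + 2d − 2d/y + 2d(2d+1)/y² − 4d²(2d+3)/y³ − 256d⁵/y⁴` for every `y ≥ 1`

Topic `Literature/Probability/RandomPlanarGeometry` (continues `SAWPulledBridgeFreeEnergyZdThirdOrderLower.lean`: the block laws
`p₁, …, p₄`, the quartic envelope and the method «insert the third-order upper envelope `E ≤ S₃` in the denominators, clear them,
certify positivity by the coefficients in `(y − 1, d − 1)`»; uses the cost-4 census of `SAWPulledLargeForceExpansionZdFourthOrder`: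
`N_{4,5} = 2d(2d−1)³ − 2d(2d−2)`, `N_{4,6} = 2d(2d−1)`).

The fourth large-force coefficient `c_4^{(d)} = −4d²(2d+3)` comes from the cost-4 cells `N_{4,5}` (inside the fifth block) and `N_{4,6}` (the
hooks, inside the sixth block).  Keeping, in the gap-free sub-Kesten inequality `Σ_i p_i(y) ≤ 1`, the full first four blocks and only these two
cells of the fifth and sixth (every cell is `≥ 0`) gives the SEXTIC lower envelope
`E⁶ ≥ yE⁵ + 2dyE⁴ + 2d(2d−1)yE³ + 2d(2d−1)²yE² + N_{4,5}·yE + N_{4,6}·y²` for `E = e^{λ_B(y)}`, every `y > 0`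
(`exp_pulledBridgeFreeEnergy_sextic_le`), whose expansion is correct through `c_4^{(d)}/y³`.  In
`E − y ≥ 2dy/E + 2d(2d−1)y/E² + 2d(2d−1)²y/E³ + N_{4,5}y/E⁴ + N_{4,6}y²/E⁵` we insert the third-order UPPER envelope `E ≤ S₃` in the first two
denominators and the first-order one `E ≤ y + 2d` with Bernoulli's inequality (`y/(y+2d)³ ≥ 1/y² − 6d/y³`, `y/(y+2d)⁴ ≥ 1/y³ − 8d/y⁴`,
`y²/(y+2d)⁵ ≥ 1/y³ − 10d/y⁴`) in the last three; clearing the denominator `y⁴(y²S₃)²` leaves a polynomial of degree `6` in `y` whose 57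
coefficients in `(y − 1, d − 1)` are positive (`fourth_order_poly_certificate`).  Hence

* ★★★ **`fourth_order_sub_le_exp_pulledBridgeFreeEnergy : y + 2d − 2d/y + 2d(2d+1)/y² − 4d²(2d+3)/y³ − 256d⁵/y⁴ ≤ e^{λ_B(y)}`** on
  `ℤ^{d+1}` for every `y ≥ 1` and every `d` — the large-force expansion `1, 2d, −2d, 2d(2d+1), −4d²(2d+3), …` truncated after its FOURTH
  coefficient is a lower bound up to `256d⁵/y⁴`, uniformly in the dimension (the tree's `exp_pulledBridgeFreeEnergy_fourth_order_zd` is the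
  `∃ C y₁` form; keeping `S₃` in all five denominators gives the constant `48` with a 186-term certificate of degree `15`, too large for one
  `ring` call; the matching upper bound at this order would be the fifth-order truncation, cf. the memory-three remark in the docstring of
  `exp_pulledBridgeFreeEnergy_sextic_le`).

Printed status: first order is Janse van Rensburg–Whittington (2013, §3.2 Theorem 8); explicit fourth-order envelopes uniform in `d` are, to our
knowledge, not in print.  Provenance: lane «pcv-sawmu», a-p3 g26 (2026-08-28).  PURE STD, no data, no `decide`.
-/

noncomputable section

open Finset Filter Topology
open scoped BigOperators
open Literature.Probability.LatticeModels
open Literature.Probability.RandomPlanarGeometry.SAW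

namespace Literature.Probability.RandomPlanarGeometry.SAW.Zd

/-! ### Six cells of the renewal structure -/

/-- The cost-4 cell of the fifth block: `N_{4,5}·u⁵/y⁴ ≤ p_5(y)` (every cell of `p_5 = Σ_c N_{c,5} u⁵/y^c` is nonnegative).
[cite: Beaton2015, §3, Lemma 1, eq. (7)] [cite: MadrasSlade1993, §4.2, eq. (4.2.20)–(4.2.22) (p. 94, 2013 reprint)] -/
theorem cell_four_five_le_pulledBlockLaw (d : ℕ) {y : ℝ} (hy : 0 < y) :
    (2 * d * (2 * d - 1) ^ 3 - 2 * d * (2 * d - 2)) * largeForceUZd d y ^ 5 / y ^ 4 ≤ pulledBlockLaw (d + 1) y 5 := by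
  have hu0 : 0 ≤ largeForceUZd d y := (largeForceUZd_pos d hy).le
  rw [pulledBlockLaw_eq_sum_costCoeffZd d hy 5]
  have hmem : 4 ∈ Finset.range (5 + 1) := by simp
  have h := Finset.single_le_sum (f := fun c => (costCoeffZd d c 5 : ℝ) * largeForceUZd d y ^ 5 / y ^ c)
    (fun c _ => by positivity) hmem
  have hN : ((costCoeffZd d 4 5 : ℕ) : ℝ) = 2 * d * (2 * d - 1) ^ 3 - 2 * d * (2 * d - 2) := by
    have h45 := costCoeffZd_four_five_add d
    rcases Nat.eq_zero_or_pos d with rfl | hd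
    · have : costCoeffZd 0 4 5 = 0 := by simpa using h45
      simp [this]
    · have hcast : ((costCoeffZd d 4 5 : ℕ) : ℝ) + 2 * d * (2 * d - 2) = 2 * d * (2 * d - 1) ^ 3 := by
        have := congrArg (fun m : ℕ => (m : ℝ)) h45
        push_cast [Nat.cast_sub (show 2 ≤ 2 * d by omega), Nat.cast_sub (show 1 ≤ 2 * d by omega)] at this
        linarith
      linarith
  simpa [hN] using h

/-- The cost-4 cell of the sixth block (the hooks): `N_{4,6}·u⁶/y⁴ = 2d(2d−1)·u⁶/y⁴ ≤ p_6(y)`.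
[cite: Beaton2015, §3, Lemma 1, eq. (7)] [cite: MadrasSlade1993, §4.2, eq. (4.2.20)–(4.2.22) (p. 94, 2013 reprint)] -/
theorem cell_four_six_le_pulledBlockLaw (d : ℕ) {y : ℝ} (hy : 0 < y) :
    2 * d * (2 * d - 1) * largeForceUZd d y ^ 6 / y ^ 4 ≤ pulledBlockLaw (d + 1) y 6 := by
  have hu0 : 0 ≤ largeForceUZd d y := (largeForceUZd_pos d hy).le
  rw [pulledBlockLaw_eq_sum_costCoeffZd d hy 6]
  have hmem : 4 ∈ Finset.range (6 + 1) := by simp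
  have h := Finset.single_le_sum (f := fun c => (costCoeffZd d c 6 : ℝ) * largeForceUZd d y ^ 6 / y ^ c)
    (fun c _ => by positivity) hmem
  have hN : ((costCoeffZd d 4 6 : ℕ) : ℝ) = 2 * d * (2 * d - 1) := by
    rw [costCoeffZd_four_six]
    rcases Nat.eq_zero_or_pos d with rfl | hd
    · simp
    · rw [Nat.cast_mul, Nat.cast_sub (by omega)]; push_cast; ring
  simpa [hN] using h

/-- **Six cells of the sub-Kesten inequality**: `u + 2du²/y + 2d(2d−1)u³/y² + 2d(2d−1)²u⁴/y³ + N_{4,5}u⁵/y⁴ + N_{4,6}u⁶/y⁴ ≤ 1` for every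
`y > 0` (`p₁ + ⋯ + p₆ ≤ 1`, blocks five and six cut down to their cost-4 cells). [cite: Beaton2015, §3, Lemma 2; MadrasSlade1993, §4.2, eq. (4.2.15)] -/
theorem largeForceUZd_six_cells_le_one (d : ℕ) {y : ℝ} (hy : 0 < y) :
    largeForceUZd d y + 2 * d * largeForceUZd d y ^ 2 / y + 2 * d * (2 * d - 1) * largeForceUZd d y ^ 3 / y ^ 2
      + 2 * d * (2 * d - 1) ^ 2 * largeForceUZd d y ^ 4 / y ^ 3
      + (2 * d * (2 * d - 1) ^ 3 - 2 * d * (2 * d - 2)) * largeForceUZd d y ^ 5 / y ^ 4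
      + 2 * d * (2 * d - 1) * largeForceUZd d y ^ 6 / y ^ 4 ≤ 1 := by
  have h := sum_range_pulledBlockLaw_le_one d hy 7
  simp only [Finset.sum_range_succ, Finset.sum_range_zero, pulledBlockLaw_zero, pulledBlockLaw_one_eq_largeForceUZd,
    pulledBlockLaw_two_eq d hy, pulledBlockLaw_three_eq d hy, pulledBlockLaw_four_eq d hy, zero_add] at h
  have h5 := cell_four_five_le_pulledBlockLaw d hy
  have h6 := cell_four_six_le_pulledBlockLaw d hy
  linarith

/-- ★★ **The sextic lower envelope**: `y·E⁵ + 2dy·E⁴ + 2d(2d−1)y·E³ + 2d(2d−1)²y·E² + (2d(2d−1)³ − 2d(2d−2))y·E + 2d(2d−1)·y² ≤ E⁶`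
for `E = e^{λ_B(y)}` on `ℤ^{d+1}`, every `y > 0`, every `d`.  (Its expansion is exact through `c_4^{(d)}/y³`; an UPPER bound at this order
needs the memory-three transfer operator — squares excluded — whose tilted Perron root reproduces `c_0, …, c_5`.)
[cite: Beaton2015, §3, Lemma 2] [cite: JansevanRensburgWhittington2013, §3.2 Theorem 8 (arXiv v4 p. 11)] -/
theorem exp_pulledBridgeFreeEnergy_sextic_le (d : ℕ) {y : ℝ} (hy : 0 < y) :
    y * Real.exp (pulledBridgeFreeEnergy (d + 1) y) ^ 5 + 2 * d * y * Real.exp (pulledBridgeFreeEnergy (d + 1) y) ^ 4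
        + 2 * d * (2 * d - 1) * y * Real.exp (pulledBridgeFreeEnergy (d + 1) y) ^ 3
        + 2 * d * (2 * d - 1) ^ 2 * y * Real.exp (pulledBridgeFreeEnergy (d + 1) y) ^ 2
        + (2 * d * (2 * d - 1) ^ 3 - 2 * d * (2 * d - 2)) * y * Real.exp (pulledBridgeFreeEnergy (d + 1) y)
        + 2 * d * (2 * d - 1) * y ^ 2
      ≤ Real.exp (pulledBridgeFreeEnergy (d + 1) y) ^ 6 := by
  set E := Real.exp (pulledBridgeFreeEnergy (d + 1) y) with hE
  have hE0 : 0 < E := Real.exp_pos _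
  have hu : largeForceUZd d y = y / E := by rw [largeForceUZd, Real.exp_neg, div_eq_mul_inv]
  have h := largeForceUZd_six_cells_le_one d hy
  rw [hu] at h
  have key : y / E + 2 * d * (y / E) ^ 2 / y + 2 * d * (2 * d - 1) * (y / E) ^ 3 / y ^ 2 + 2 * d * (2 * d - 1) ^ 2 * (y / E) ^ 4 / y ^ 3
        + (2 * d * (2 * d - 1) ^ 3 - 2 * d * (2 * d - 2)) * (y / E) ^ 5 / y ^ 4 + 2 * d * (2 * d - 1) * (y / E) ^ 6 / y ^ 4
      = (y * E ^ 5 + 2 * d * y * E ^ 4 + 2 * d * (2 * d - 1) * y * E ^ 3 + 2 * d * (2 * d - 1) ^ 2 * y * E ^ 2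
          + (2 * d * (2 * d - 1) ^ 3 - 2 * d * (2 * d - 2)) * y * E + 2 * d * (2 * d - 1) * y ^ 2) / E ^ 6 := by
    field_simp
  rw [key, div_le_one (by positivity)] at h
  exact h

/-- `E − y ≥ 2dy/E + 2d(2d−1)y/E² + 2d(2d−1)²y/E³ + N_{4,5}y/E⁴ + N_{4,6}y²/E⁵`. [cite: JansevanRensburgWhittington2013, §3.2 Theorem 8 (arXiv v4 p. 11)] -/
theorem five_cells_div_le_exp_pulledBridgeFreeEnergy_sub (d : ℕ) {y : ℝ} (hy : 0 < y) :
    2 * d * y / Real.exp (pulledBridgeFreeEnergy (d + 1) y) + 2 * d * (2 * d - 1) * y / Real.exp (pulledBridgeFreeEnergy (d + 1) y) ^ 2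
        + 2 * d * (2 * d - 1) ^ 2 * y / Real.exp (pulledBridgeFreeEnergy (d + 1) y) ^ 3
        + (2 * d * (2 * d - 1) ^ 3 - 2 * d * (2 * d - 2)) * y / Real.exp (pulledBridgeFreeEnergy (d + 1) y) ^ 4
        + 2 * d * (2 * d - 1) * y ^ 2 / Real.exp (pulledBridgeFreeEnergy (d + 1) y) ^ 5
      ≤ Real.exp (pulledBridgeFreeEnergy (d + 1) y) - y := by
  set E := Real.exp (pulledBridgeFreeEnergy (d + 1) y) with hE
  have hE0 : 0 < E := Real.exp_pos _
  have hq := exp_pulledBridgeFreeEnergy_sextic_le d hy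
  have key : 2 * d * y / E + 2 * d * (2 * d - 1) * y / E ^ 2 + 2 * d * (2 * d - 1) ^ 2 * y / E ^ 3
        + (2 * d * (2 * d - 1) ^ 3 - 2 * d * (2 * d - 2)) * y / E ^ 4 + 2 * d * (2 * d - 1) * y ^ 2 / E ^ 5
      = (2 * d * y * E ^ 4 + 2 * d * (2 * d - 1) * y * E ^ 3 + 2 * d * (2 * d - 1) ^ 2 * y * E ^ 2
          + (2 * d * (2 * d - 1) ^ 3 - 2 * d * (2 * d - 2)) * y * E + 2 * d * (2 * d - 1) * y ^ 2) / E ^ 5 := by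
    field_simp
  rw [key, div_le_iff₀ (by positivity)]
  nlinarith

/-! ### Bernoulli lower bounds, the polynomial certificate and the fourth-order lower envelope -/

/-- Bernoulli: `y/(y+2d)³ ≥ 1/y² − 6d/y³` for `y > 0`, `d ≥ 0` (`(y−6d)(y+2d)³ = y⁴ − 24d²y² − 64d³y − 48d⁴ ≤ y⁴`). [folklore] -/
private theorem bernoulli_cube {y D : ℝ} (hy : 0 < y) (hD : 0 ≤ D) :
    1 / y ^ 2 - 6 * D / y ^ 3 ≤ y / (y + 2 * D) ^ 3 := by
  have hU : 0 < y + 2 * D := by positivity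
  rw [div_sub_div _ _ (by positivity) (by positivity), div_le_div_iff₀ (by positivity) (by positivity)]
  nlinarith [mul_nonneg hD hy.le, pow_pos hy 3, pow_pos hy 4, mul_nonneg (mul_nonneg hD hD) (mul_nonneg hy.le hy.le),
    mul_nonneg (pow_nonneg hD 3) hy.le, pow_nonneg hD 4, pow_pos hy 2, mul_nonneg (pow_nonneg hD 2) (pow_nonneg hy.le 5),
    mul_nonneg (pow_nonneg hD 3) (pow_nonneg hy.le 4), mul_nonneg (pow_nonneg hD 4) (pow_nonneg hy.le 3)]

/-- Bernoulli: `y/(y+2d)⁴ ≥ 1/y³ − 8d/y⁴` for `y > 0`, `d ≥ 0`. [folklore] -/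
private theorem bernoulli_fourth {y D : ℝ} (hy : 0 < y) (hD : 0 ≤ D) :
    1 / y ^ 3 - 8 * D / y ^ 4 ≤ y / (y + 2 * D) ^ 4 := by
  have hU : 0 < y + 2 * D := by positivity
  have key : y / (y + 2 * D) ^ 4 - (1 / y ^ 3 - 8 * D / y ^ 4) =
      (y ^ 5 - (y - 8 * D) * (y + 2 * D) ^ 4) / (y ^ 4 * (y + 2 * D) ^ 4) := by
    field_simp
  have hnum : 0 ≤ y ^ 5 - (y - 8 * D) * (y + 2 * D) ^ 4 := by
    have : y ^ 5 - (y - 8 * D) * (y + 2 * D) ^ 4 = 40 * D ^ 2 * y ^ 3 + 160 * D ^ 3 * y ^ 2 + 240 * D ^ 4 * y + 128 * D ^ 5 := by ring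
    rw [this]; positivity
  have : 0 ≤ (y ^ 5 - (y - 8 * D) * (y + 2 * D) ^ 4) / (y ^ 4 * (y + 2 * D) ^ 4) := by positivity
  linarith

/-- Bernoulli: `y²/(y+2d)⁵ ≥ 1/y³ − 10d/y⁴` for `y > 0`, `d ≥ 0`. [folklore] -/
private theorem bernoulli_fifth {y D : ℝ} (hy : 0 < y) (hD : 0 ≤ D) :
    1 / y ^ 3 - 10 * D / y ^ 4 ≤ y ^ 2 / (y + 2 * D) ^ 5 := by
  have hU : 0 < y + 2 * D := by positivity
  have key : y ^ 2 / (y + 2 * D) ^ 5 - (1 / y ^ 3 - 10 * D / y ^ 4) =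
      (y ^ 6 - (y - 10 * D) * (y + 2 * D) ^ 5) / (y ^ 4 * (y + 2 * D) ^ 5) := by
    field_simp
  have hnum : 0 ≤ y ^ 6 - (y - 10 * D) * (y + 2 * D) ^ 5 := by
    have : y ^ 6 - (y - 10 * D) * (y + 2 * D) ^ 5 =
        60 * D ^ 2 * y ^ 4 + 320 * D ^ 3 * y ^ 3 + 720 * D ^ 4 * y ^ 2 + 768 * D ^ 5 * y + 320 * D ^ 6 := by ring
    rw [this]; positivity
  have : 0 ≤ (y ^ 6 - (y - 10 * D) * (y + 2 * D) ^ 5) / (y ^ 4 * (y + 2 * D) ^ 5) := by positivity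
  linarith

/-- **The positivity certificate** (57 monomials): with `y = 1 + t`, `d = 1 + e` (`t, e ≥ 0`), `N = y³ + 2dy² − 2dy + 2d(2d+1)` (`= y²·S₃`),
`c₃ = 2d(2d−1)²`, `M₄₅ = 2d(2d−1)³ − 2d(2d−2)`, `M₄₆ = 2d(2d−1)`, the polynomial
`2dy⁷N + (4d²−2d)y⁹ + N²·(c₃(y² − 6dy) + M₄₅(y − 8d) + M₄₆(y − 10d)) − (2dy⁴ − 2dy³ + 2d(2d+1)y² − 4d²(2d+3)y − 256d⁵)·N²`
has only positive coefficients in `(t, e)`. [folklore] -/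
private theorem fourth_order_poly_certificate {y D : ℝ} (hy : 1 ≤ y) (hD : 1 ≤ D) :
    0 ≤ 2 * D * y ^ 7 * (y ^ 3 + 2 * D * y ^ 2 - 2 * D * y + 2 * D * (2 * D + 1)) + (4 * D ^ 2 - 2 * D) * y ^ 9
        + (y ^ 3 + 2 * D * y ^ 2 - 2 * D * y + 2 * D * (2 * D + 1)) ^ 2 *
          (2 * D * (2 * D - 1) ^ 2 * (y ^ 2 - 6 * D * y) + (2 * D * (2 * D - 1) ^ 3 - 2 * D * (2 * D - 2)) * (y - 8 * D)
            + 2 * D * (2 * D - 1) * (y - 10 * D))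
        - (2 * D * y ^ 4 - 2 * D * y ^ 3 + 2 * D * (2 * D + 1) * y ^ 2 - 4 * D ^ 2 * (2 * D + 3) * y - 256 * D ^ 5)
          * (y ^ 3 + 2 * D * y ^ 2 - 2 * D * y + 2 * D * (2 * D + 1)) ^ 2 := by
  obtain ⟨t, ht, rfl⟩ : ∃ t : ℝ, 0 ≤ t ∧ y = 1 + t := ⟨y - 1, by linarith, by ring⟩
  obtain ⟨e, he, rfl⟩ : ∃ e : ℝ, 0 ≤ e ∧ D = 1 + e := ⟨D - 1, by linarith, by ring⟩
  have key : 2 * (1 + e) * (1 + t) ^ 7 * ((1 + t) ^ 3 + 2 * (1 + e) * (1 + t) ^ 2 - 2 * (1 + e) * (1 + t) + 2 * (1 + e) * (2 * (1 + e) + 1))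
        + (4 * (1 + e) ^ 2 - 2 * (1 + e)) * (1 + t) ^ 9
        + ((1 + t) ^ 3 + 2 * (1 + e) * (1 + t) ^ 2 - 2 * (1 + e) * (1 + t) + 2 * (1 + e) * (2 * (1 + e) + 1)) ^ 2 *
          (2 * (1 + e) * (2 * (1 + e) - 1) ^ 2 * ((1 + t) ^ 2 - 6 * (1 + e) * (1 + t))
            + (2 * (1 + e) * (2 * (1 + e) - 1) ^ 3 - 2 * (1 + e) * (2 * (1 + e) - 2)) * ((1 + t) - 8 * (1 + e))
            + 2 * (1 + e) * (2 * (1 + e) - 1) * ((1 + t) - 10 * (1 + e)))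
        - (2 * (1 + e) * (1 + t) ^ 4 - 2 * (1 + e) * (1 + t) ^ 3 + 2 * (1 + e) * (2 * (1 + e) + 1) * (1 + t) ^ 2
            - 4 * (1 + e) ^ 2 * (2 * (1 + e) + 3) * (1 + t) - 256 * (1 + e) ^ 5)
          * ((1 + t) ^ 3 + 2 * (1 + e) * (1 + t) ^ 2 - 2 * (1 + e) * (1 + t) + 2 * (1 + e) * (2 * (1 + e) + 1)) ^ 2
      =
        11188 + 85664 * e + 289588 * e ^ 2 + 567448 * e ^ 3 +
        710480 * e ^ 4 + 589504 * e ^ 5 + 324032 * e ^ 6 + 113664 * e ^ 7 +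
        23040 * e ^ 8 + 2048 * e ^ 9 + 16184 * t + 106000 * t * e +
        298376 * t * e ^ 2 + 470240 * t * e ^ 3 + 452368 * t * e ^ 4 + 270752 * t * e ^ 5 +
        97728 * t * e ^ 6 + 19200 * t * e ^ 7 + 1536 * t * e ^ 8 + 21756 * t ^ 2 +
        136768 * t ^ 2 * e + 369932 * t ^ 2 * e ^ 2 + 562184 * t ^ 2 * e ^ 3 + 525504 * t ^ 2 * e ^ 4 +
        309952 * t ^ 2 * e ^ 5 + 112832 * t ^ 2 * e ^ 6 + 23168 * t ^ 2 * e ^ 7 + 2048 * t ^ 2 * e ^ 8 +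
        14728 * t ^ 3 + 82424 * t ^ 3 * e + 192648 * t ^ 3 * e ^ 2 + 242472 * t ^ 3 * e ^ 3 +
        176624 * t ^ 3 * e ^ 4 + 74208 * t ^ 3 * e ^ 5 + 16640 * t ^ 3 * e ^ 6 + 1536 * t ^ 3 * e ^ 7 +
        7956 * t ^ 4 + 42440 * t ^ 4 * e + 93908 * t ^ 4 * e ^ 2 + 110816 * t ^ 4 * e ^ 3 +
        74752 * t ^ 4 * e ^ 4 + 28736 * t ^ 4 * e ^ 5 + 5888 * t ^ 4 * e ^ 6 + 512 * t ^ 4 * e ^ 7 +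
        2288 * t ^ 5 + 11224 * t ^ 5 * e + 22384 * t ^ 5 * e ^ 2 + 23000 * t ^ 5 * e ^ 3 +
        12688 * t ^ 5 * e ^ 4 + 3520 * t ^ 5 * e ^ 5 + 384 * t ^ 5 * e ^ 6 + 220 * t ^ 6 +
        920 * t ^ 6 * e + 1484 * t ^ 6 * e ^ 2 + 1120 * t ^ 6 * e ^ 3 + 368 * t ^ 6 * e ^ 4 +
        32 * t ^ 6 * e ^ 5 := by
    ring
  rw [key]
  positivity

/-- **The fourth-order rational lower bound**: for `y ≥ 1`, `D ≥ 1`, `S = y + 2D − 2D/y + 2D(2D+1)/y²`,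
`2Dy/S + 2D(2D−1)y/S² + 2D(2D−1)²(1/y² − 6D/y³) + (2D(2D−1)³ − 2D(2D−2))(1/y³ − 8D/y⁴) + 2D(2D−1)(1/y³ − 10D/y⁴)
 ≥ 2D − 2D/y + 2D(2D+1)/y² − 4D²(2D+3)/y³ − 256D⁵/y⁴`. [cite: JansevanRensburgWhittington2013, §3.2 Theorem 8 (arXiv v4 p. 11)] -/
theorem five_cells_at_envelopes_ge {y D : ℝ} (hy : 1 ≤ y) (hD : 1 ≤ D) :
    2 * D - 2 * D / y + 2 * D * (2 * D + 1) / y ^ 2 - 4 * D ^ 2 * (2 * D + 3) / y ^ 3 - 256 * D ^ 5 / y ^ 4 ≤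
      2 * D * y / (y + 2 * D - 2 * D / y + 2 * D * (2 * D + 1) / y ^ 2)
        + 2 * D * (2 * D - 1) * y / (y + 2 * D - 2 * D / y + 2 * D * (2 * D + 1) / y ^ 2) ^ 2
        + 2 * D * (2 * D - 1) ^ 2 * (1 / y ^ 2 - 6 * D / y ^ 3)
        + (2 * D * (2 * D - 1) ^ 3 - 2 * D * (2 * D - 2)) * (1 / y ^ 3 - 8 * D / y ^ 4)
        + 2 * D * (2 * D - 1) * (1 / y ^ 3 - 10 * D / y ^ 4) := by
  have hy0 : 0 < y := by linarith
  have hD0 : 0 < D := by linarith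
  set N : ℝ := y ^ 3 + 2 * D * y ^ 2 - 2 * D * y + 2 * D * (2 * D + 1) with hN
  have hN0 : 0 < N := by
    have h' : 2 * D * y ^ 2 - 2 * D * y = 2 * D * y * (y - 1) := by ring
    have : 0 ≤ 2 * D * y ^ 2 - 2 * D * y := by rw [h']; exact mul_nonneg (by positivity) (by linarith)
    have : 0 < y ^ 3 := by positivity
    have : 0 < 2 * D * (2 * D + 1) := by positivity
    linarith
  have hS : y + 2 * D - 2 * D / y + 2 * D * (2 * D + 1) / y ^ 2 = N / y ^ 2 := by
    rw [hN, eq_div_iff (by positivity)]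
    field_simp
  rw [hS]
  have hcert := fourth_order_poly_certificate hy hD
  rw [← hN] at hcert
  rw [← sub_nonneg]
  have key : 2 * D * y / (N / y ^ 2) + 2 * D * (2 * D - 1) * y / (N / y ^ 2) ^ 2
        + 2 * D * (2 * D - 1) ^ 2 * (1 / y ^ 2 - 6 * D / y ^ 3)
        + (2 * D * (2 * D - 1) ^ 3 - 2 * D * (2 * D - 2)) * (1 / y ^ 3 - 8 * D / y ^ 4)
        + 2 * D * (2 * D - 1) * (1 / y ^ 3 - 10 * D / y ^ 4)
        - (2 * D - 2 * D / y + 2 * D * (2 * D + 1) / y ^ 2 - 4 * D ^ 2 * (2 * D + 3) / y ^ 3 - 256 * D ^ 5 / y ^ 4)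
      = (2 * D * y ^ 7 * N + (4 * D ^ 2 - 2 * D) * y ^ 9
          + N ^ 2 * (2 * D * (2 * D - 1) ^ 2 * (y ^ 2 - 6 * D * y) + (2 * D * (2 * D - 1) ^ 3 - 2 * D * (2 * D - 2)) * (y - 8 * D)
            + 2 * D * (2 * D - 1) * (y - 10 * D))
          - (2 * D * y ^ 4 - 2 * D * y ^ 3 + 2 * D * (2 * D + 1) * y ^ 2 - 4 * D ^ 2 * (2 * D + 3) * y - 256 * D ^ 5) * N ^ 2)
          / (y ^ 4 * N ^ 2) := by
    field_simp
    ring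
  rw [key]
  positivity

/-- ★★★ **THE FOURTH-ORDER LOWER ENVELOPE**: `y + 2d − 2d/y + 2d(2d+1)/y² − 4d²(2d+3)/y³ − 256d⁵/y⁴ ≤ e^{λ_B(y)}` on `ℤ^{d+1}` for every
`y ≥ 1` and every `d` (`E − y ≥ Σ_{five cells}(E)`; `E ≤ S₃` in the first two cells, `E ≤ y + 2d` + Bernoulli in the last three; the
certificate; `d = 0`: `E = y`). [cite: JansevanRensburgWhittington2013, §3.2 Theorem 8 (arXiv v4 p. 11)] [cite: Beaton2015, §3, Lemma 2] -/
theorem fourth_order_sub_le_exp_pulledBridgeFreeEnergy (d : ℕ) {y : ℝ} (hy : 1 ≤ y) :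
    y + 2 * d - 2 * d / y + 2 * d * (2 * d + 1) / y ^ 2 - 4 * d ^ 2 * (2 * d + 3) / y ^ 3 - 256 * d ^ 5 / y ^ 4
      ≤ Real.exp (pulledBridgeFreeEnergy (d + 1) y) := by
  have hy0 : 0 < y := zero_lt_one.trans_le hy
  rcases Nat.eq_zero_or_pos d with rfl | hd
  · have h := (exp_pulledBridgeFreeEnergy_mem_Icc 0 hy).1
    simpa using h
  have hD : (1 : ℝ) ≤ d := by exact_mod_cast hd
  set E := Real.exp (pulledBridgeFreeEnergy (d + 1) y) with hE
  have hE0 : 0 < E := Real.exp_pos _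
  set S : ℝ := y + 2 * d - 2 * d / y + 2 * d * (2 * d + 1) / y ^ 2 with hSdef
  have hES : E ≤ S := exp_pulledBridgeFreeEnergy_le_third_order d hy
  have hEU : E ≤ y + 2 * d := exp_pulledBridgeFreeEnergy_le_add d hy
  have hU0 : 0 < y + 2 * (d : ℝ) := by positivity
  have hcells := five_cells_div_le_exp_pulledBridgeFreeEnergy_sub d hy0
  have hd1 : (0 : ℝ) ≤ 2 * d - 1 := by linarith
  have h45 : (0 : ℝ) ≤ 2 * d * (2 * d - 1) ^ 3 - 2 * d * (2 * d - 2) := by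
    have : (2 : ℝ) * d - 2 ≤ (2 * d - 1) ^ 3 := by nlinarith
    nlinarith
  have h1 : 2 * d * y / S ≤ 2 * d * y / E := div_le_div_of_nonneg_left (by positivity) hE0 hES
  have h2 : 2 * d * (2 * d - 1) * y / S ^ 2 ≤ 2 * d * (2 * d - 1) * y / E ^ 2 :=
    div_le_div_of_nonneg_left (by positivity) (by positivity) (pow_le_pow_left₀ hE0.le hES 2)
  have h3 : 2 * d * (2 * d - 1) ^ 2 * (1 / y ^ 2 - 6 * d / y ^ 3) ≤ 2 * d * (2 * d - 1) ^ 2 * y / E ^ 3 := by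
    have hb := bernoulli_cube hy0 (show (0 : ℝ) ≤ d by positivity)
    have hm : y / (y + 2 * d) ^ 3 ≤ y / E ^ 3 := div_le_div_of_nonneg_left hy0.le (by positivity) (pow_le_pow_left₀ hE0.le hEU 3)
    have := mul_le_mul_of_nonneg_left (hb.trans hm) (show (0 : ℝ) ≤ 2 * d * (2 * d - 1) ^ 2 by positivity)
    simpa [mul_div_assoc] using this
  have h4 : (2 * d * (2 * d - 1) ^ 3 - 2 * d * (2 * d - 2)) * (1 / y ^ 3 - 8 * d / y ^ 4)
      ≤ (2 * d * (2 * d - 1) ^ 3 - 2 * d * (2 * d - 2)) * y / E ^ 4 := by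
    have hb := bernoulli_fourth hy0 (show (0 : ℝ) ≤ d by positivity)
    have hm : y / (y + 2 * d) ^ 4 ≤ y / E ^ 4 := div_le_div_of_nonneg_left hy0.le (by positivity) (pow_le_pow_left₀ hE0.le hEU 4)
    have := mul_le_mul_of_nonneg_left (hb.trans hm) h45
    simpa [mul_div_assoc] using this
  have h5 : 2 * d * (2 * d - 1) * (1 / y ^ 3 - 10 * d / y ^ 4) ≤ 2 * d * (2 * d - 1) * y ^ 2 / E ^ 5 := by
    have hb := bernoulli_fifth hy0 (show (0 : ℝ) ≤ d by positivity)
    have hm : y ^ 2 / (y + 2 * d) ^ 5 ≤ y ^ 2 / E ^ 5 :=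
      div_le_div_of_nonneg_left (by positivity) (by positivity) (pow_le_pow_left₀ hE0.le hEU 5)
    have := mul_le_mul_of_nonneg_left (hb.trans hm) (show (0 : ℝ) ≤ 2 * d * (2 * d - 1) by positivity)
    simpa [mul_div_assoc] using this
  have hcert := five_cells_at_envelopes_ge hy hD
  rw [← hSdef] at hcert
  linarith

/-- The same as a remainder estimate: `−256d⁵/y⁴ ≤ e^{λ_B(y)} − (y + 2d − 2d/y + 2d(2d+1)/y² − 4d²(2d+3)/y³)` for every `y ≥ 1`, every `d`
(the upper side at this order, `≤ c_5^{(d)}/y⁴ + …`, is NOT claimed here). [cite: JansevanRensburgWhittington2013, §3.2 Theorem 8 (arXiv v4 p. 11)] -/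
theorem neg_le_exp_pulledBridgeFreeEnergy_sub_fourth_order (d : ℕ) {y : ℝ} (hy : 1 ≤ y) :
    -(256 * (d : ℝ) ^ 5 / y ^ 4) ≤
      Real.exp (pulledBridgeFreeEnergy (d + 1) y) - (y + 2 * d - 2 * d / y + 2 * d * (2 * d + 1) / y ^ 2 - 4 * d ^ 2 * (2 * d + 3) / y ^ 3) := by
  have h := fourth_order_sub_le_exp_pulledBridgeFreeEnergy d hy
  linarith

end Literature.Probability.RandomPlanarGeometry.SAW.Zd
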